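/-
Copyright (c) 2026 the pub-hodgecm-mathlib formalisation cell (harness21).  Prover seat hodgecm-mathlib-K2Liu-p03 (g7): Track B «K2-LIT»,
#184♮ = hLiu418 = stmt-HodgeConjecture-24832, road `K2_Liu`, socket #42S payer road, organ S4 (glue), brick (asm-3AB) of my (asm-3) census
`K2/K2Liu-p03/g7/CENSUS-asm3-StdSectionCoherentExpansion.K2Liu-p03-g7.md` (STEPS A+B: ★ #31s × ★ S3-F4′∕σ1 glued — «away purity» of a standard section).
-/
import Summits.HodgeConjecture.HodgeConjecture.Theorems.K2LiuKFiniteSectionMultiPlaceArchFinite   -- ★ σ1 (S3-F4′ + `K_∞`-finiteness of the away-coefficients)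
import Summits.HodgeConjecture.HodgeConjecture.Theorems.K2LiuStdFamilyFactorisable               -- ★ #31s `stdFamilyFactorisable`
import Summits.HodgeConjecture.HodgeConjecture.Theorems.K2LiuStdDatumLevelOffS                   -- ★ Φ3a `exists_finset_level_of_isStandardSectionFamily` (#31s's `_hK`, `_hR` discharged)
import Summits.HodgeConjecture.HodgeConjecture.Theorems.K2LiuSWGeneratorGoodPlaces               -- ★ (S4-good) `eventually_forall_exists_siegelDelta_mul_localInt` (local Iwasawa a.e.)
import HarnessLib

/-!
# Crux `HLiu418`, road `K2_Liu`, socket #42S, organ S4, brick (asm-3AB): AWAY PURITY OF A STANDARD SECTION —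
# `f(s₀)(h) = (Σᵢ Aᵢ(h_∞) · ∏_{v∈S} b_{i,v}(h_v)) · ∏ᶠ_{v∉S} Λ_{s₀,v}(h_v)` with `b_{i,v} ∈ I_v(s₀, χ_v)`, `Aᵢ` archimedean Siegel sections, `K_∞`-finite

Cell `hodgecm-mathlib`, crux item hLiu418 = `stmt-HodgeConjecture-24832`; squad K2 ∕ K2Liu; prover K2Liu-p03 (g7).  THEOREMS ONLY (no `def`, no instance, no notation,
no named-fact hypothesis, no `sorry`); lane `--supports stmt-HodgeConjecture-24832 --as helper`.

THE A∕B SEAM OF THE (asm-3) CENSUS, DISCHARGED.  For a STANDARD Iwasawa datum `𝒦`, a `𝒦`-standard family `f` with `f s` continuous and a parameter `s₀` there is a finite `S₀` such that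
for every finite `S ⊇ S₀`: (A) ★ #31s `stdFamilyFactorisable` — its by-value hypotheses discharged: `K^S_H ⊆ 𝒦.K` and right-`K^S_H`-invariance at `s₀` by ★ Φ3a
`exists_finset_level_of_isStandardSectionFamily`, `χ` unramified off `S` (★ `UnitaryGroup.eventually_forall_placesOver` + ★ `HeckeCharacter.isUnramifiedAt_cofinite_holds`), the local Iwasawa decomposition off `S`
(★ (S4-good) `eventually_forall_exists_siegelDelta_mul_localInt`) — gives `f s h = f s (placesEmbed(h_∞, h_S)) · ∏ᶠ_{v∉S} Λ_{s,v}(h_v)`; (B) ★ σ1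
`exists_sum_pure_on_finset_degPS_archFinite` at `T := S` gives `f s₀ h′ = Σᵢ aᵢ(h′) ∏_{v∈S} b_{i,v}(h′_v)` with `K_∞`-finite `aᵢ` right-invariant under every `ι_v(H_v)`, `v ∈ S`;
at `h′ := placesEmbed(h_∞, h_S)` the `S`-components are `h_v` and — §1–§2, a finite-support stripping by induction on `S` — `aᵢ(placesEmbed(h_∞, h_S)) = aᵢ(archToAdelic h_∞)`.
* §1 `finAdelic_eq_one_of_forall_evalPlace_eq_one`, `apply_mul_eq_of_forall_evalPlace_eq_one` — a function right-invariant under `ι_v(H_v)` for `v ∈ T` does not see a right factor `k`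
  with `k_∞ = 1` and `k_v = 1` off `T` (induction on `T`, peeling `ι_w(k_w)`: ★ S3 `evalPlace_finPart_mul_inv_locToAdelic`).
* §2 `apply_placesEmbed_eq_apply_archToAdelic` — hence `a(placesEmbed(h_∞, y)) = a(archToAdelic h_∞)`.
* §3 **`exists_awayPurity`** — THE HEAD: `∃ S₀, ∀ S ⊇ S₀, ∃ m b A`, (i) `b i v ∈ localDegPS_v(χ, s₀)` (`v ∈ S`); (ii) `A i` is `K_∞`-FINITE: it lies in a finite-dimensional
  `V_∞ ≤ (H_∞ → ℂ)` stable under `G ↦ G(· a₀)` for every `a₀` with `archToAdelic a₀ ∈ 𝒦.K` (★ (S4-Kfin)'s quantifier); (iii) `A i` is an ARCHIMEDEAN SIEGEL SECTION of weight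
  `(χ, s₀)`: `A i (p_∞ a) = siegelDeltaCharacter χ s₀ p · A i a` for `p ∈ P_Δ(𝔸)` with `p_f = 1`; (iv) `f s₀ h = (Σᵢ A i (h_∞) · ∏_{v∈S} b i v (h_v)) · ∏ᶠ_{v∉S} Λ_{s₀,v}(h_v)`.
[Liu2011, §2B p. 862]; [Tan1999, §1 p. 166]; [BorelJacquet1979, §4.1]; [Flath1979, §2]; [HarrisKudlaSweet1996, §1 (1.15)–(1.17)]; [KudlaRallis1994, §1].
HONEST LABEL.  Count-neutral helper: `HC_CM` is proved only modulo the 7 printed citations (2 remaining named inputs: hLiu418 = `stmt-HodgeConjecture-24832`,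
h413 = `stmt-HodgeConjecture-24833`) until rung 0 closes.
-/

set_option autoImplicit false
set_option linter.dupNamespace false -- the mandated namespace repeats `HodgeConjecture.HodgeConjecture`

noncomputable section

open scoped Matrix Classical
open NumberField IsDedekindDomain Filter
open Literature.NumberTheory.K2Lit.PlaceSplitting
open Literature.NumberTheory.Automorphic hiding IsKFinite
open Literature.NumberTheory.GaloisRepresentations
open Literature.NumberTheory.GelbartRogawski1991 Literature.NumberTheory.GelbartRogawski1991.GRConstruction
open Literature.NumberTheory.GelbartRogawski1991.UnitaryDualPair Literature.NumberTheory.GelbartRogawski1991.UnitaryDualPair.LocalSplitting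
open Literature.NumberTheory.K2Lit.SiegelDoubled Literature.NumberTheory.K2Lit.LocalSiegelDoubled
open Summit.HodgeConjecture.HodgeConjecture.Cruxes.HLiu418.K2LiuStdFamilyFactorisable
open Summit.HodgeConjecture.HodgeConjecture.Cruxes.HLiu418.K2LiuStdDatumLevelOffS
open Summit.HodgeConjecture.HodgeConjecture.Cruxes.HLiu418.K2LiuDoublingHeightQuasiFactorization (evalPlace_finPart_mul_inv_locToAdelic)
open Summit.HodgeConjecture.HodgeConjecture.Cruxes.HLiu418.K2LiuSWGeneratorGoodPlaces (eventually_forall_exists_siegelDelta_mul_localInt)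
open Summit.HodgeConjecture.HodgeConjecture.Cruxes.HLiu418.K2LiuKFiniteSectionMultiPlaceArchFinite

namespace Summit.HodgeConjecture.HodgeConjecture.Cruxes.HLiu418.K2LiuStdSectionAwayPurity

variable (L : Type) [Field L] [NumberField L] [IsCMField L]
variable {N M n : ℕ} (e : Fin N × Fin M ≃ Fin n)
  (dV : Fin N → L) (hdV : ∀ i, IsCMField.complexConj L (dV i) = dV i) (hdV0 : ∀ i, dV i ≠ 0)
  (dW : Fin M → L) (hdW : ∀ i, IsCMField.complexConj L (dW i) = dW i) (hdW0 : ∀ i, dW i ≠ 0)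

/-! ## §1 Stripping a finitely supported right factor -/

/-- a finite-adelic element all of whose place components are `1` is `1` (★ `finAdelicEquiv` is injective; Mathlib `RestrictedProduct.ext`). [cite: BorelJacquet1979, §4.1] -/
theorem finAdelic_eq_one_of_forall_evalPlace_eq_one
    (b : UnitaryGroup.finAdelic (Fp L) L (IsCMField.complexConj L) (n + n) (hermD L e dV hdV dW hdW))
    (hb : ∀ v : HeightOneSpectrum (𝓞 (Fp L)), UnitaryGroup.evalPlace (Fp L) L (IsCMField.complexConj L) (n + n) (hermD L e dV hdV dW hdW) v b = 1) : b = 1 :=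
  (UnitaryGroup.finAdelicEquiv (Fp L) L (IsCMField.complexConj L) (n + n) (hermD L e dV hdV dW hdW)).injective
    ((DFunLike.ext _ _ fun v => hb v).trans (map_one _).symm)

/-- **a function right-invariant under `ι_v(H_v)` for all `v ∈ T` does not see a right factor supported on `T`**: if `k_∞ = 1` and `k_v = 1` for `v ∉ T` then `a (x k) = a x`
(induction on `T`, peeling off `ι_w(k_w)`: `k = (k·ι_w(k_w)⁻¹)·ι_w(k_w)` with ★ `evalPlace_finPart_mul_inv_locToAdelic`). [cite: BorelJacquet1979, §4.1] [cite: Flath1979, §2] -/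
theorem apply_mul_eq_of_forall_evalPlace_eq_one {a : HA L e dV hdV dW hdW → ℂ} (T : Finset (HeightOneSpectrum (𝓞 (Fp L))))
    (hinv : ∀ v ∈ T, ∀ (x : HA L e dV hdV dW hdW) (u : UnitaryGroup.localPi L (IsCMField.complexConj L) (n + n) (hermD L e dV hdV dW hdW) v), a (x * locToAdelic L e dV hdV dW hdW v u) = a x) :
    ∀ k : HA L e dV hdV dW hdW, UnitaryGroup.archPart (Fp L) L (IsCMField.complexConj L) (n + n) (hermD L e dV hdV dW hdW) k = 1 → (∀ v, v ∉ T → UnitaryGroup.evalPlace (Fp L) L (IsCMField.complexConj L) (n + n) (hermD L e dV hdV dW hdW) v (UnitaryGroup.finPart (Fp L) L (IsCMField.complexConj L) (n + n) (hermD L e dV hdV dW hdW) k) = 1) → ∀ x : HA L e dV hdV dW hdW, a (x * k) = a x := by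
  induction T using Finset.induction_on with
  | empty =>
    intro k hka hkf x
    have hk1 : k = 1 :=
      eq_of_archPart_eq_of_finPart_eq L e dV hdV dW hdW k 1 (by rw [hka, archPart_one']) (by
        rw [finPart_one']
        exact finAdelic_eq_one_of_forall_evalPlace_eq_one L e dV hdV dW hdW _ fun v => hkf v (Finset.notMem_empty v))
    rw [hk1, mul_one]
  | insert w T hw ih =>
    intro k hka hkf x
    -- peel off the `w`-component: `k = k′ · ι_w(k_w)` with `k′_w = 1`
    have hk : k = k * (locToAdelic L e dV hdV dW hdW w (UnitaryGroup.evalPlace (Fp L) L (IsCMField.complexConj L) (n + n) (hermD L e dV hdV dW hdW) w (UnitaryGroup.finPart (Fp L) L (IsCMField.complexConj L) (n + n) (hermD L e dV hdV dW hdW) k)))⁻¹ * locToAdelic L e dV hdV dW hdW w (UnitaryGroup.evalPlace (Fp L) L (IsCMField.complexConj L) (n + n) (hermD L e dV hdV dW hdW) w (UnitaryGroup.finPart (Fp L) L (IsCMField.complexConj L) (n + n) (hermD L e dV hdV dW hdW) k)) :=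
      (inv_mul_cancel_right _ _).symm
    have h1 : a (x * k) = a (x * (k * (locToAdelic L e dV hdV dW hdW w (UnitaryGroup.evalPlace (Fp L) L (IsCMField.complexConj L) (n + n) (hermD L e dV hdV dW hdW) w (UnitaryGroup.finPart (Fp L) L (IsCMField.complexConj L) (n + n) (hermD L e dV hdV dW hdW) k)))⁻¹)) := by
      conv_lhs => rw [hk, ← mul_assoc]
      exact hinv w (Finset.mem_insert_self w T) _ _
    rw [h1]
    refine ih (fun v hv => hinv v (Finset.mem_insert_of_mem hv)) _ ?_ (fun v hv => ?_) x
    · rw [archPart_mul', archPart_inv', hka, archPart_locToAdelic, inv_one, mul_one]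
    · by_cases hvw : v = w
      · subst hvw
        exact evalPlace_finPart_mul_inv_locToAdelic L e dV hdV dW hdW v k
      · rw [evalPlace_finPart_mul', evalPlace_finPart_inv', evalPlace_finPart_locToAdelic_of_ne L e dV hdV dW hdW hvw, inv_one, mul_one]
        exact hkf v fun h => (Finset.mem_insert.1 h).elim hvw hv

/-! ## §2 Away-functions evaluated at `placesEmbed(h_∞, h_S)` -/

/-- **`a (placesEmbed S (h_∞, y)) = a (archToAdelic h_∞)`** for `a` right-invariant under `ι_v(H_v)`, `v ∈ S` (§1 with `k := (archToAdelic h_∞)⁻¹ · placesEmbed S (h_∞, y)`,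
whose components off `S` are `1`, ★ `evalPlace_finPart_placesEmbed_of_not_mem`). [cite: Liu2011, §2B p. 862] [cite: BorelJacquet1979, §4.1] -/
theorem apply_placesEmbed_eq_apply_archToAdelic {a : HA L e dV hdV dW hdW → ℂ} (S : Finset (HeightOneSpectrum (𝓞 (Fp L))))
    (hinv : ∀ v ∈ S, ∀ (x : HA L e dV hdV dW hdW) (u : UnitaryGroup.localPi L (IsCMField.complexConj L) (n + n) (hermD L e dV hdV dW hdW) v), a (x * locToAdelic L e dV hdV dW hdW v u) = a x)
    (ainf : UnitaryGroup.arch (Fp L) L (IsCMField.complexConj L) (n + n) (hermD L e dV hdV dW hdW)) (y : Π v : S, UnitaryGroup.localPi L (IsCMField.complexConj L) (n + n) (hermD L e dV hdV dW hdW) v.1) :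
    a (placesEmbed L (hermD L e dV hdV dW hdW) S (ainf, y)) = a (UnitaryGroup.archToAdelic (Fp L) L (IsCMField.complexConj L) (n + n) (hermD L e dV hdV dW hdW) ainf) := by
  have hdec : (placesEmbed L (hermD L e dV hdV dW hdW) S (ainf, y) : HA L e dV hdV dW hdW) =
      (UnitaryGroup.archToAdelic (Fp L) L (IsCMField.complexConj L) (n + n) (hermD L e dV hdV dW hdW) ainf : HA L e dV hdV dW hdW) * (((UnitaryGroup.archToAdelic (Fp L) L (IsCMField.complexConj L) (n + n) (hermD L e dV hdV dW hdW) ainf : HA L e dV hdV dW hdW))⁻¹ * (placesEmbed L (hermD L e dV hdV dW hdW) S (ainf, y) : HA L e dV hdV dW hdW)) :=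
    (mul_inv_cancel_left _ _).symm
  rw [hdec]
  refine apply_mul_eq_of_forall_evalPlace_eq_one L e dV hdV dW hdW S hinv _ ?_ (fun v hv => ?_) _
  · rw [map_mul, map_inv, archPart_placesEmbed, UnitaryGroup.archPart_archToAdelic, inv_mul_cancel]
  · rw [map_mul, map_inv, map_mul, map_inv, evalPlace_finPart_placesEmbed_of_not_mem L e dV hdV dW hdW S ainf y v hv, UnitaryGroup.finPart_archToAdelic,
      map_one, inv_one, one_mul]

/-! ## §3 HEAD: away purity of a standard section -/

set_option maxHeartbeats 1600000 in -- ★ #31s alone needs 1 000 000 (its 40-binder telescope); plus the S3-F4′ binder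
include hdV0 hdW0 in
/-- **(asm-3AB) AWAY PURITY OF A STANDARD SECTION.**  For a STANDARD Iwasawa datum `𝒦`, a `𝒦`-standard family `f` for `χ` with `f s` continuous and a parameter `s₀`, there is a finite `S₀`
such that for every finite `S ⊇ S₀` there are `m`, local factors `b i v` and archimedean coefficients `A i : H_∞ → ℂ` with:
(i) `b i v ∈ I_v(s₀, χ_v)` (★ `localDegPS`) for `v ∈ S`; (ii) each `A i` lies in a finite-dimensional `V_∞ ≤ (H_∞ → ℂ)` stable under `G ↦ G(· a₀)` for all `a₀` with `archToAdelic a₀ ∈ 𝒦.K`;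
(iii) `A i (p_∞ · a) = siegelDeltaCharacter χ s₀ p · A i a` for every `p ∈ P_Δ(𝔸)` with `p_f = 1`; (iv) `f s₀ h = (Σᵢ A i (h_∞) · ∏_{v∈S} b i v (h_v)) · ∏ᶠ_{v∉S} Λ_{s₀,v}(h_v)`.
[cite: Liu2011, §2B p. 862] [cite: Tan1999, §1 p. 166] [cite: HarrisKudlaSweet1996, §1 (1.15)–(1.17)] [cite: BorelJacquet1979, §4.1] [cite: KudlaRallis1994, §1] -/
theorem exists_awayPurity {𝒦 : IwasawaDatum L e dV hdV dW hdW} (h𝒦 : 𝒦.IsStd) {χ : HeckeCharacter L} {f : ℂ → HA L e dV hdV dW hdW → ℂ}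
    (hf : IsStandardSectionFamily 𝒦 χ f) (hfc : ∀ s, Continuous (f s)) (s₀ : ℂ) :
    ∃ S₀ : Finset (HeightOneSpectrum (𝓞 (Fp L))), ∀ S : Finset (HeightOneSpectrum (𝓞 (Fp L))), S₀ ⊆ S →
      ∃ (m : ℕ) (b : Fin m → (v : HeightOneSpectrum (𝓞 (Fp L))) → (UnitaryGroup.localPi L (IsCMField.complexConj L) (n + n) (hermD L e dV hdV dW hdW) v → ℂ)) (A : Fin m → UnitaryGroup.arch (Fp L) L (IsCMField.complexConj L) (n + n) (hermD L e dV hdV dW hdW) → ℂ),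
        (∀ i, ∀ v ∈ S, b i v ∈ localDegPS (Fp L) L (IsCMField.complexConj L) (complexConj_imagUnit L) (imagUnit_ne_zero L) (imagUnit_mul_self L)
          v n (gramR_isSymm L e dV hdV dW hdW) (hermD_eq_map_gramD L e dV hdV dW hdW) (fun w => χ.localComponent w.1) s₀) ∧
        (∀ i, ∃ V : Submodule ℂ (UnitaryGroup.arch (Fp L) L (IsCMField.complexConj L) (n + n) (hermD L e dV hdV dW hdW) → ℂ), FiniteDimensional ℂ V ∧ A i ∈ V ∧
          ∀ a₀ : UnitaryGroup.arch (Fp L) L (IsCMField.complexConj L) (n + n) (hermD L e dV hdV dW hdW), (UnitaryGroup.archToAdelic (Fp L) L (IsCMField.complexConj L) (n + n) (hermD L e dV hdV dW hdW) a₀ : HA L e dV hdV dW hdW) ∈ 𝒦.K → ∀ G ∈ V, (fun x => G (x * a₀)) ∈ V) ∧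
        (∀ i, ∀ p : HA L e dV hdV dW hdW, IsSiegelDelta L e dV hdV dW hdW p → UnitaryGroup.finPart (Fp L) L (IsCMField.complexConj L) (n + n) (hermD L e dV hdV dW hdW) p = 1 →
          ∀ x : UnitaryGroup.arch (Fp L) L (IsCMField.complexConj L) (n + n) (hermD L e dV hdV dW hdW), A i (UnitaryGroup.archPart (Fp L) L (IsCMField.complexConj L) (n + n) (hermD L e dV hdV dW hdW) p * x) = siegelDeltaCharacter L e dV hdV dW hdW χ s₀ p * A i x) ∧
        ∀ h : HA L e dV hdV dW hdW, f s₀ h =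
          (∑ i, A i (UnitaryGroup.archPart (Fp L) L (IsCMField.complexConj L) (n + n) (hermD L e dV hdV dW hdW) h) * ∏ v ∈ S, b i v (UnitaryGroup.evalPlace (Fp L) L (IsCMField.complexConj L) (n + n) (hermD L e dV hdV dW hdW) v (UnitaryGroup.finPart (Fp L) L (IsCMField.complexConj L) (n + n) (hermD L e dV hdV dW hdW) h))) *
            ∏ᶠ v : {v : HeightOneSpectrum (𝓞 (Fp L)) // v ∉ S},
              LambdaLoc L e dV hdV dW hdW v.1 χ s₀ (UnitaryGroup.evalPlace (Fp L) L (IsCMField.complexConj L) (n + n) (hermD L e dV hdV dW hdW) v.1 (UnitaryGroup.finPart (Fp L) L (IsCMField.complexConj L) (n + n) (hermD L e dV hdV dW hdW) h)) := by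
  haveI : Algebra.IsQuadraticExtension (Fp L) L := IsCMField.isQuadraticExtension L
  -- the three cofinite guards: level (★ Φ3a), `χ` unramified, local Iwasawa
  obtain ⟨S₁, hS₁⟩ := exists_finset_level_of_isStandardSectionFamily L e dV hdV dW hdW h𝒦 hf hfc s₀
  obtain ⟨T₂, hT₂⟩ : ∃ T₂ : Finset (HeightOneSpectrum (𝓞 (Fp L))), ∀ v ∉ T₂, ∀ w : UnitaryGroup.PlacesOver L v, χ.IsUnramifiedAt w.1 :=
    ⟨(Filter.eventually_cofinite.1 (UnitaryGroup.eventually_forall_placesOver (F := Fp L) L (Q := fun w => χ.IsUnramifiedAt w)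
        (HeckeCharacter.isUnramifiedAt_cofinite_holds χ))).toFinset,
      fun v hv => by
        by_contra h1
        exact hv ((Set.Finite.mem_toFinset _).2 h1)⟩
  obtain ⟨T₃, hT₃⟩ : ∃ T₃ : Finset (HeightOneSpectrum (𝓞 (Fp L))), ∀ v ∉ T₃, ∀ x : UnitaryGroup.localPi L (IsCMField.complexConj L) (n + n) (hermD L e dV hdV dW hdW) v,
      ∃ p ∈ siegelDeltaLoc L e dV hdV dW hdW v, ∃ k ∈ UnitaryGroup.localInt L (IsCMField.complexConj L) (n + n) (hermD L e dV hdV dW hdW) v, x = p * k :=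
    ⟨(Filter.eventually_cofinite.1 (eventually_forall_exists_siegelDelta_mul_localInt L e dV hdV hdV0 dW hdW hdW0)).toFinset, fun v hv => by
      by_contra h1
      exact hv ((Set.Finite.mem_toFinset _).2 h1)⟩
  refine ⟨S₁ ∪ T₂ ∪ T₃, fun S hS => ?_⟩
  have hS₁S : S₁ ⊆ S := (Finset.subset_union_left.trans Finset.subset_union_left).trans hS
  have hχS : ∀ v, v ∉ S → ∀ w : UnitaryGroup.PlacesOver L v, χ.IsUnramifiedAt w.1 :=
    fun v hv => hT₂ v fun h => hv (hS (Finset.mem_union_left _ (Finset.mem_union_right _ h)))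
  have hIwS : ∀ v, v ∉ S → ∀ x : UnitaryGroup.localPi L (IsCMField.complexConj L) (n + n) (hermD L e dV hdV dW hdW) v, ∃ p ∈ siegelDeltaLoc L e dV hdV dW hdW v, ∃ k ∈ UnitaryGroup.localInt L (IsCMField.complexConj L) (n + n) (hermD L e dV hdV dW hdW) v, x = p * k :=
    fun v hv => hT₃ v fun h => hv (hS (Finset.mem_union_right _ h))
  -- (A) ★ #31s
  obtain ⟨-, hfac⟩ := stdFamilyFactorisable L e dV hdV hdV0 dW hdW hdW0 S χ hχS hIwS 𝒦 f hf (hS₁ S hS₁S).1 s₀ (hS₁ S hS₁S).2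
  -- (B) ★ σ1 at `T := S`
  obtain ⟨Uf, m, b, a, -, -, hb, ha, hfin, hsum⟩ := exists_sum_pure_on_finset_degPS_archFinite h𝒦 hf hfc s₀ S
  refine ⟨m, b, fun i x => a i (UnitaryGroup.archToAdelic (Fp L) L (IsCMField.complexConj L) (n + n) (hermD L e dV hdV dW hdW) x), fun i v hv => (hb i v hv).1, fun i => ?_, fun i p hp hpf x => ?_, fun h => ?_⟩
  · -- (ii) `K_∞`-finiteness of `A i = a i ∘ archToAdelic`
    obtain ⟨V, hVfd, haV, hstab⟩ := hfin i
    haveI := hVfd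
    refine ⟨V.map (LinearMap.funLeft ℂ ℂ fun x : UnitaryGroup.arch (Fp L) L (IsCMField.complexConj L) (n + n) (hermD L e dV hdV dW hdW) => (UnitaryGroup.archToAdelic (Fp L) L (IsCMField.complexConj L) (n + n) (hermD L e dV hdV dW hdW) x : HA L e dV hdV dW hdW)), Module.Finite.map V _, ⟨a i, haV, rfl⟩,
      fun a₀ ha₀ G hG => ?_⟩
    obtain ⟨G', hG', rfl⟩ := hG
    refine ⟨fun h => G' (h * UnitaryGroup.archToAdelic (Fp L) L (IsCMField.complexConj L) (n + n) (hermD L e dV hdV dW hdW) a₀), hstab _ ha₀ (UnitaryGroup.finPart_archToAdelic _ _ _ _ _ _) G' hG', funext fun x => ?_⟩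
    simp only [LinearMap.funLeft_apply, map_mul]
  · -- (iii) the archimedean Siegel law
    show a i (UnitaryGroup.archToAdelic (Fp L) L (IsCMField.complexConj L) (n + n) (hermD L e dV hdV dW hdW) (UnitaryGroup.archPart (Fp L) L (IsCMField.complexConj L) (n + n) (hermD L e dV hdV dW hdW) p * x)) = siegelDeltaCharacter L e dV hdV dW hdW χ s₀ p * a i (UnitaryGroup.archToAdelic (Fp L) L (IsCMField.complexConj L) (n + n) (hermD L e dV hdV dW hdW) x)
    have hp' : (UnitaryGroup.archToAdelic (Fp L) L (IsCMField.complexConj L) (n + n) (hermD L e dV hdV dW hdW) (UnitaryGroup.archPart (Fp L) L (IsCMField.complexConj L) (n + n) (hermD L e dV hdV dW hdW) p) : HA L e dV hdV dW hdW) = p := by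
      have h1 := UnitaryGroup.archToAdelic_mul_finAdelicToAdelic (Fp L) L (IsCMField.complexConj L) (n + n) (hermD L e dV hdV dW hdW) p
      rw [hpf, map_one, mul_one] at h1
      exact h1
    rw [map_mul, hp']
    exact (ha i).1 p hp (fun v _ => by rw [hpf, map_one]) _
  · -- (iv) the identity
    have hA := hfac s₀ h
    beta_reduce at hA
    rw [hA, hsum]
    congr 1
    refine Finset.sum_congr rfl fun i _ => ?_
    rw [apply_placesEmbed_eq_apply_archToAdelic L e dV hdV dW hdW S (ha i).2.2]
    congr 1
    exact Finset.prod_congr rfl fun v hv => by rw [evalPlace_finPart_placesEmbed_of_mem L e dV hdV dW hdW S _ _ v hv]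

end Summit.HodgeConjecture.HodgeConjecture.Cruxes.HLiu418.K2LiuStdSectionAwayPurity

end
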